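import Summits.Ventures.PercRepro.S1CFNullity

/-!
# PercRepro — THE CIRCUITS OF SIZE `k` OF A SET OF NULLITY `ν` NUMBER AT MOST `C(ν + k − 1, k)` (p1, gen 37)

The generic counting engine of the ν = 4 caps (p7's ν = 4 program). For an independent `S` and a set `Y` disjoint from
it, the **`S`-relative circuits of size `k` inside `Y`** (the family `{P | P ⊆ Y ∧ |P| = k ∧ Dep (S ∪ P) ∧ ∀ Q ⊂ P, Indep (S ∪ Q)}`,
written out in every statement — no definition) are the `k`-subsets `P ⊆ Y` with `S ∪ P`
dependent and `S ∪ Q` independent for every proper subset `Q ⊂ P` — the circuits of size `k` of the contraction by `S`.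
**`ncard_relCircuits_le`**: if `S ∪ Y` has nullity `≤ ν` (`|S ∪ Y| ≤ rk (S ∪ Y) + ν`) then
the family has at most `C(ν + k − 1, k)` members (`1 ≤ k`). Induction on `k`, then on `ν`: pick `P` in the family and `x ∈ P`;
the members avoiding `x` are relative circuits of `Y ∖ {x}`, whose nullity is one less (`x ∈ cl (S ∪ (P ∖ {x}))`), and the
members through `x` inject (`P ↦ P ∖ {x}`) into the `(insert x S)`-relative circuits of size `k − 1` of `Y ∖ {x}` (same
nullity); Pascal adds up. The base `k = 1` counts the points of `Y` in `cl S`, at most the nullity.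
Consequences: **`ncard_isCircuit_ncard_eq_le`** (the circuits of size `k` inside a set of nullity `≤ ν` number
`≤ C(ν + k − 1, k)`: pairs `≤ C(ν + 1, 2)`, triangles `≤ C(ν + 2, 3)`, `4`-circuits `≤ C(ν + 3, 4)`). Nothing about any
cell is claimed. Axioms: standard.
-/

open scoped Matroid

namespace PercRepro

namespace S1CF

open Set

variable {α : Type}

/-- The relative circuits inside `Y ⊆ E` form a finite family. -/
theorem relCircuits_finite (M : Matroid α) [M.Finite] (S : Set α) {Y : Set α} (hY : Y ⊆ M.E) (k : ℕ) :
    ({P : Set α | P ⊆ Y ∧ P.ncard = k ∧ M.Dep (S ∪ P) ∧ ∀ Q, Q ⊂ P → M.Indep (S ∪ Q)}).Finite :=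
  M.ground_finite.finite_subsets.subset (fun _ hP => hP.1.trans hY)

/-- **The base `k = 1`**: the `S`-relative circuits of size `1` inside `Y` number at most the nullity of `S ∪ Y`. -/
theorem ncard_relCircuits_one_le (M : Matroid α) [M.Finite] {ν : ℕ} {S Y : Set α} (hS : S ⊆ M.E)
    (hY : Y ⊆ M.E) (hSY : Disjoint S Y) (hSi : M.Indep S)
    (hν : (S ∪ Y).ncard ≤ (M.eRk (S ∪ Y)).toNat + ν) : ({P : Set α | P ⊆ Y ∧ P.ncard = 1 ∧ M.Dep (S ∪ P) ∧ ∀ Q, Q ⊂ P → M.Indep (S ∪ Q)}).ncard ≤ ν := by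
  classical
  have hEfin := M.ground_finite
  set U : Set α := {u ∈ Y | M.Dep (S ∪ {u})} with hUdef
  have hUY : U ⊆ Y := fun u hu => hu.1
  have hUE : U ⊆ M.E := hUY.trans hY
  -- the relative circuits of size 1 are the singletons of `U`
  have himg : {P : Set α | P ⊆ Y ∧ P.ncard = 1 ∧ M.Dep (S ∪ P) ∧ ∀ Q, Q ⊂ P → M.Indep (S ∪ Q)} ⊆ (fun u => ({u} : Set α)) '' U := by
    intro P hP
    obtain ⟨hPY, hP1, hPdep, -⟩ := hP
    obtain ⟨u, rfl⟩ := Set.ncard_eq_one.1 hP1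
    exact ⟨u, ⟨hPY (mem_singleton u), hPdep⟩, rfl⟩
  have hUfin : U.Finite := hEfin.subset hUE
  have h1 : ({P : Set α | P ⊆ Y ∧ P.ncard = 1 ∧ M.Dep (S ∪ P) ∧ ∀ Q, Q ⊂ P → M.Indep (S ∪ Q)}).ncard ≤ U.ncard :=
    (Set.ncard_le_ncard himg (hUfin.image _)).trans (Set.ncard_image_le hUfin)
  -- `U ⊆ cl S`
  have hUcl : U ⊆ M.closure S := by
    intro u hu
    have hdep : M.Dep (insert u S) := by
      have : S ∪ {u} = insert u S := by rw [union_singleton]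
      rw [← this]; exact hu.2
    rw [hSi.insert_dep_iff] at hdep
    exact hdep.1
  -- rank of `S ∪ U` is `|S|`
  have hrk : M.eRk (U ∪ S) = M.eRk S := eRk_union_eq_of_subset_closure M hS hUcl
  have hSU : U ∪ S ⊆ S ∪ Y := by rw [union_comm]; exact union_subset_union_right S hUY
  have hmono := ncard_add_eRk_le_of_subset M (union_subset hS hY) hSU
  rw [hrk] at hmono
  have hSfin : S.Finite := hEfin.subset hS
  have hdisj : Disjoint U S := (hSY.mono_right hUY).symm
  have hcard : (U ∪ S).ncard = U.ncard + S.ncard := Set.ncard_union_eq hdisj hUfin hSfin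
  have hSrk : (M.eRk S).toNat = S.ncard := by
    rw [hSi.eRk_eq_encard, hSfin.cast_ncard_eq.symm]; simp
  omega

/-- A set of nullity `0` has no relative circuits. -/
theorem relCircuits_eq_empty_of_nullity_zero (M : Matroid α) [M.Finite] {S Y : Set α} (hS : S ⊆ M.E)
    (hY : Y ⊆ M.E) (hν : (S ∪ Y).ncard ≤ (M.eRk (S ∪ Y)).toNat) (k : ℕ) :
    {P : Set α | P ⊆ Y ∧ P.ncard = k ∧ M.Dep (S ∪ P) ∧ ∀ Q, Q ⊂ P → M.Indep (S ∪ Q)} = ∅ := by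
  have hSY : S ∪ Y ⊆ M.E := union_subset hS hY
  have hfin : (S ∪ Y).Finite := M.ground_finite.subset hSY
  have hind : M.Indep (S ∪ Y) := by
    rw [Matroid.indep_iff_eRk_eq_encard_of_finite hfin]
    apply le_antisymm (M.eRk_le_encard _)
    rw [← S1.coe_toNat_eRk M hSY, ← hfin.cast_ncard_eq]
    exact_mod_cast hν
  ext P
  simp only [Set.mem_setOf_eq, Set.mem_empty_iff_false, iff_false, not_and]
  intro hPY _ hdep _
  exact hdep.not_indep (hind.subset (union_subset_union_right S hPY))

/-- **THE RELATIVE CIRCUIT COUNT**: for `S` independent, `Y` disjoint from `S`, and `S ∪ Y` of nullity `≤ ν`, the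
`S`-relative circuits of size `k ≥ 1` inside `Y` number at most `C(ν + k − 1, k)`. -/
theorem ncard_relCircuits_le (M : Matroid α) [M.Finite] (k : ℕ) (hk : 1 ≤ k) :
    ∀ (ν : ℕ) (S Y : Set α), S ⊆ M.E → Y ⊆ M.E → Disjoint S Y → M.Indep S →
      (S ∪ Y).ncard ≤ (M.eRk (S ∪ Y)).toNat + ν →
      ({P : Set α | P ⊆ Y ∧ P.ncard = k ∧ M.Dep (S ∪ P) ∧ ∀ Q, Q ⊂ P → M.Indep (S ∪ Q)}).ncard ≤ (ν + k - 1).choose k := by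
  classical
  induction k with
  | zero => omega
  | succ k ihk =>
    intro ν
    induction ν with
    | zero =>
      intro S Y hS hY _ _ hν
      rw [relCircuits_eq_empty_of_nullity_zero M hS hY (by simpa using hν)]
      simp
    | succ ν ihν =>
      intro S Y hS hY hSY hSi hν
      rcases Nat.eq_zero_or_pos k with hk0 | hkpos
      · -- `k + 1 = 1`: the base
        subst hk0
        have := ncard_relCircuits_one_le M hS hY hSY hSi hν
        simpa using this
      -- `k + 1 ≥ 2`
      by_cases hempty : {P : Set α | P ⊆ Y ∧ P.ncard = (k + 1) ∧ M.Dep (S ∪ P) ∧ ∀ Q, Q ⊂ P → M.Indep (S ∪ Q)} = ∅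
      · rw [hempty]; simp
      obtain ⟨P, hP⟩ := Set.nonempty_iff_ne_empty.2 hempty
      obtain ⟨hPY, hPk, hPdep, hPmin⟩ := hP
      have hPfin : P.Finite := M.ground_finite.subset (hPY.trans hY)
      have hPne : P.Nonempty := by
        rw [← Set.ncard_pos hPfin, hPk]; omega
      obtain ⟨x, hxP⟩ := hPne
      have hxY : x ∈ Y := hPY hxP
      have hxS : x ∉ S := fun h => hSY.notMem_of_mem_left h hxY
      have hxE : x ∈ M.E := hY hxY
      -- `x ∈ cl (S ∪ (P ∖ {x}))`
      have hPx : P \ {x} ⊂ P := Set.sdiff_singleton_ssubset.2 hxP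
      have hind : M.Indep (S ∪ (P \ {x})) := hPmin _ hPx
      have hxcl : x ∈ M.closure (S ∪ (P \ {x})) := by
        rw [hind.mem_closure_iff]
        left
        have : insert x (S ∪ (P \ {x})) = S ∪ P := by
          ext y
          simp only [Set.mem_insert_iff, Set.mem_union, Set.mem_sdiff, Set.mem_singleton_iff]
          constructor
          · rintro (rfl | h | ⟨h, -⟩)
            · exact Or.inr hxP
            · exact Or.inl h
            · exact Or.inr h
          · rintro (h | h)
            · exact Or.inr (Or.inl h)
            · by_cases hyx : y = x
              · exact Or.inl hyx
              · exact Or.inr (Or.inr ⟨h, hyx⟩)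
        rw [this]; exact hPdep
      have hxclY : x ∈ M.closure (S ∪ (Y \ {x})) :=
        M.closure_subset_closure (union_subset_union_right S (Set.sdiff_subset_sdiff_left hPY)) hxcl
      -- the two pieces
      set A := {P : Set α | P ⊆ (Y \ {x}) ∧ P.ncard = (k + 1) ∧ M.Dep (S ∪ P) ∧ ∀ Q, Q ⊂ P → M.Indep (S ∪ Q)} with hAdef
      set B := {P : Set α | P ⊆ (Y \ {x}) ∧ P.ncard = k ∧ M.Dep ((insert x S) ∪ P) ∧ ∀ Q, Q ⊂ P → M.Indep ((insert x S) ∪ Q)} with hBdef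
      have hsplit : {P : Set α | P ⊆ Y ∧ P.ncard = (k + 1) ∧ M.Dep (S ∪ P) ∧ ∀ Q, Q ⊂ P → M.Indep (S ∪ Q)} ⊆ A ∪ (fun Q => insert x Q) '' B := by
        intro P' hP'
        obtain ⟨hP'Y, hP'k, hP'dep, hP'min⟩ := hP'
        by_cases hxP' : x ∈ P'
        · right
          refine ⟨P' \ {x}, ?_, Set.insert_sdiff_singleton.trans (Set.insert_eq_of_mem hxP')⟩
          have hP'fin : P'.Finite := M.ground_finite.subset (hP'Y.trans hY)
          refine ⟨Set.sdiff_subset_sdiff_left hP'Y, ?_, ?_, ?_⟩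
          · rw [Set.ncard_sdiff_singleton_of_mem hxP', hP'k]; simp
          · have : insert x S ∪ (P' \ {x}) = S ∪ P' := by
              ext y
              simp only [Set.mem_union, Set.mem_insert_iff, Set.mem_sdiff, Set.mem_singleton_iff]
              constructor
              · rintro ((rfl | h) | ⟨h, -⟩)
                · exact Or.inr hxP'
                · exact Or.inl h
                · exact Or.inr h
              · rintro (h | h)
                · exact Or.inl (Or.inr h)
                · by_cases hyx : y = x
                  · exact Or.inl (Or.inl hyx)
                  · exact Or.inr ⟨h, hyx⟩
            rw [this]; exact hP'dep
          · intro Q hQ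
            have h1 : insert x S ∪ Q = S ∪ insert x Q := by
              ext y
              simp only [Set.mem_union, Set.mem_insert_iff]
              tauto
            have h2 : insert x Q ⊂ P' := by
              refine ⟨Set.insert_subset hxP' (hQ.subset.trans Set.sdiff_subset), ?_⟩
              intro hcon
              apply hQ.not_subset
              intro y hy
              rcases hcon hy.1 with hyx | hyQ
              · exact absurd hyx hy.2
              · exact hyQ
            rw [h1]; exact hP'min _ h2
        · left
          exact ⟨Set.subset_sdiff_singleton hP'Y hxP', hP'k, hP'dep, hP'min⟩
      have hYx : Y \ {x} ⊆ M.E := Set.sdiff_subset.trans hY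
      have hAfin : A.Finite := relCircuits_finite M S hYx (k + 1)
      have hBfin : B.Finite := relCircuits_finite M (insert x S) hYx k
      have hcardA : A.ncard ≤ (ν + (k + 1) - 1).choose (k + 1) := by
        apply ihν S (Y \ {x}) hS hYx (hSY.mono_right Set.sdiff_subset) hSi
        -- nullity of `S ∪ (Y ∖ {x})` is one less
        have hU : S ∪ Y = insert x (S ∪ (Y \ {x})) := by
          ext y
          simp only [Set.mem_union, Set.mem_insert_iff, Set.mem_sdiff, Set.mem_singleton_iff]
          constructor
          · rintro (h | h)
            · exact Or.inr (Or.inl h)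
            · by_cases hyx : y = x
              · exact Or.inl hyx
              · exact Or.inr (Or.inr ⟨h, hyx⟩)
          · rintro (rfl | h | ⟨h, -⟩)
            · exact Or.inr hxY
            · exact Or.inl h
            · exact Or.inr h
        have hxnot : x ∉ S ∪ (Y \ {x}) := by
          simp only [Set.mem_union, Set.mem_sdiff, Set.mem_singleton_iff, not_true_eq_false, and_false,
            or_false]
          exact hxS
        have hfin' : (S ∪ (Y \ {x})).Finite := M.ground_finite.subset (union_subset hS hYx)
        have hrk : M.eRk (S ∪ Y) = M.eRk (S ∪ (Y \ {x})) := by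
          rw [hU, ← Set.singleton_union]
          exact eRk_union_eq_of_subset_closure M (union_subset hS hYx) (by simpa using hxclY)
        rw [hU, Set.ncard_insert_of_notMem hxnot hfin', ← hU, hrk] at hν
        omega
      have hcardB : B.ncard ≤ (ν + 1 + k - 1).choose k := by
        apply ihk hkpos (ν + 1) (insert x S) (Y \ {x}) (Set.insert_subset hxE hS) hYx
        · exact Set.disjoint_insert_left.2 ⟨by simp, hSY.mono_right Set.sdiff_subset⟩
        · have : insert x S = S ∪ {x} := by rw [Set.union_singleton]
          rw [this]
          exact hPmin _ (LE.le.ssubset_of_ne (Set.singleton_subset_iff.2 hxP)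
            (fun h => by rw [← h, Set.ncard_singleton] at hPk; omega))
        · have hU : insert x S ∪ (Y \ {x}) = S ∪ Y := by
            ext y
            simp only [Set.mem_union, Set.mem_insert_iff, Set.mem_sdiff, Set.mem_singleton_iff]
            constructor
            · rintro ((rfl | h) | ⟨h, -⟩)
              · exact Or.inr hxY
              · exact Or.inl h
              · exact Or.inr h
            · rintro (h | h)
              · exact Or.inl (Or.inr h)
              · by_cases hyx : y = x
                · exact Or.inl (Or.inl hyx)
                · exact Or.inr ⟨h, hyx⟩
          rw [hU]; exact hν
      calc ({P : Set α | P ⊆ Y ∧ P.ncard = (k + 1) ∧ M.Dep (S ∪ P) ∧ ∀ Q, Q ⊂ P → M.Indep (S ∪ Q)}).ncard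
          ≤ (A ∪ (fun Q => insert x Q) '' B).ncard :=
            Set.ncard_le_ncard hsplit (hAfin.union (hBfin.image _))
        _ ≤ A.ncard + ((fun Q => insert x Q) '' B).ncard := Set.ncard_union_le _ _
        _ ≤ A.ncard + B.ncard := Nat.add_le_add_left (Set.ncard_image_le hBfin) _
        _ ≤ (ν + (k + 1) - 1).choose (k + 1) + (ν + 1 + k - 1).choose k := by gcongr
        _ = (ν + 1 + (k + 1) - 1).choose (k + 1) := by
            have h1 : ν + (k + 1) - 1 = ν + k := by omega
            have h2 : ν + 1 + k - 1 = ν + k := by omega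
            have h3 : ν + 1 + (k + 1) - 1 = ν + k + 1 := by omega
            rw [h1, h2, h3, add_comm ((ν + k).choose (k + 1)), Nat.choose_succ_succ]

/-- **The circuits of size `k` inside a set of nullity `≤ ν` number at most `C(ν + k − 1, k)`**: pairs `≤ C(ν + 1, 2)`,
triangles `≤ C(ν + 2, 3)`, `4`-circuits `≤ C(ν + 3, 4)`. -/
theorem ncard_isCircuit_ncard_eq_le (M : Matroid α) [M.Finite] {ν k : ℕ} (hk : 1 ≤ k) {Y : Set α}
    (hY : Y ⊆ M.E) (hν : Y.ncard ≤ (M.eRk Y).toNat + ν) :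
    {C : Set α | C ⊆ Y ∧ M.IsCircuit C ∧ C.ncard = k}.ncard ≤ (ν + k - 1).choose k := by
  have hsub : {C : Set α | C ⊆ Y ∧ M.IsCircuit C ∧ C.ncard = k} ⊆ {P : Set α | P ⊆ Y ∧ P.ncard = k ∧ M.Dep (∅ ∪ P) ∧ ∀ Q, Q ⊂ P → M.Indep (∅ ∪ Q)} := by
    intro C hC
    obtain ⟨hCY, hCc, hCk⟩ := hC
    refine ⟨hCY, hCk, by simpa using hCc.dep, fun Q hQ => by simpa using hCc.ssubset_indep hQ⟩
  refine (Set.ncard_le_ncard hsub (relCircuits_finite M ∅ hY k)).trans ?_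
  apply ncard_relCircuits_le M k hk ν ∅ Y (empty_subset _) hY (Set.disjoint_left.2 fun a ha => absurd ha (Set.notMem_empty a))
    M.empty_indep
  simpa using hν

end S1CF

end PercRepro
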